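import Mathlib
import HarnessLib
import Summits.HubbardSuperconductivity.HubbardSuperconductivity.Theorems.KLProgrammeH10TwoPointLimitPerturbedCountPairs
import Summits.HubbardSuperconductivity.HubbardSuperconductivity.Theorems.KLProgrammePerturbedFermiCurveDefs

/-!
# Route `KLProgramme` — crux K1 `H10TwoPointLimit` (stmt-HubbardSuperconductivity-19938):
# the uniform count on the moving curve with the canonical root selection

Consumer-facing form of `countPairs_perturbed` (`…PerturbedCountPairs.lean`): `countPairs_perturbedFermiRadius` — the same statement with the
root selection INSTANTIATED by the named radius `perturbedFermiRadius δ μ` of `KLProgrammePerturbedFermiCurveDefs.lean`, so a consumer supplies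
only the perturbation `δ` (C², even, `|δ|, ‖Dδ‖, ‖D²δ‖ ≤ κ`). (Consistency check, not landed because it restates a landed declaration: at
`δ = 0`, `u = u_μ` the moving-curve theorem yields the route item `CountPairsOffset` verbatim via `hfunE_zero_band` — elaborated rc 0 in the
seat folder, work/PerturbedCountPairsCorollaries.lean history.) Everything is PROVED; no definitions. References: BGM 2006 Lemma 3.1 / (2.76) / (2.80) [cite: BenfattoGiulianiMastropietro2006].
-/

noncomputable section

namespace Summit.HubbardSuperconductivity.HubbardSuperconductivity.Theorems.PerturbedFermiCurve

set_option linter.dupNamespace false -- summit = problem name (single-conjunct summit), D-0017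

open Real Set
open Literature.MathematicalPhysics.QuantumLattice Literature.MathematicalPhysics.QuantumLattice.BandSectorCounting
open Summit.HubbardSuperconductivity.HubbardSuperconductivity.Theorems.CountPairsOffset

/-- **The uniform count on the moving curve with the canonical root selection `perturbedFermiRadius δ μ`.** For every level range `[a, b] ⊂ (-4, 0)`,
margin `η₀` and tolerance constant `C_δ` there are `κ > 0` and `K_p` such that for every `C²` even `δ` with `|δ|, ‖Dδ‖, ‖D²δ‖ ≤ κ`, every interior `μ`,
every offset `P` and every isotropic grid: `#{(i, j) : |h^E_P(θ_i, θ_j)| ≤ C_δ w} ≤ K_p (J + 2 + log N)/w`, the legs running on the named polar curve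
`θ ↦ perturbedFermiRadius δ μ θ · dir θ` of `{ε₀ + δ = μ}`. [cite: BenfattoGiulianiMastropietro2006, Lemma 3.1 / (2.76) / (2.80)] -/
theorem countPairs_perturbedFermiRadius :
    ∀ a b : ℝ, -4 < a → a ≤ b → b < 0 → ∀ η₀ Cδ : ℝ, 0 < η₀ → 0 < Cδ →
      ∃ κ : ℝ, 0 < κ ∧ ∃ Kp : ℝ, 0 < Kp ∧
        ∀ δ : (Fin 2 → ℝ) → ℝ, ContDiff ℝ 2 δ → (∀ k, δ (-k) = δ k) →
          (∀ k : Fin 2 → ℝ, |δ k| ≤ κ) → (∀ k : Fin 2 → ℝ, ‖fderiv ℝ δ k‖ ≤ κ) → (∀ k : Fin 2 → ℝ, ‖fderiv ℝ (fderiv ℝ δ) k‖ ≤ κ) →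
        ∀ μ : ℝ, μ ∈ Set.Icc a b → a ≤ μ - η₀ → μ + η₀ ≤ b →
        ∀ (P : ℝ × ℝ) (w : ℝ) (N Nh J : ℕ), 0 < w → w ≤ 1 → (N : ℝ) * w = 2 * Real.pi → (Nh : ℝ) * w = Real.pi → N = 2 * Nh →
          (2 : ℝ) ^ J * w = Real.pi → Cδ * w ≤ η₀ / 2 →
          ((((Finset.range N ×ˢ Finset.range N).filter fun p : ℕ × ℕ =>
              |hfunE δ (perturbedFermiRadius δ μ) μ P (w / 2 + p.1 * w) (w / 2 + p.2 * w)| ≤ Cδ * w).card : ℝ)) ≤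
            Kp * ((J : ℝ) + 2 + Real.log N) / w := by
  intro a b ha hab hb η₀ Cδ hη₀ hCδ
  obtain ⟨κ, hκ, Kp, hKp, h⟩ := countPairs_perturbed a b ha hab hb η₀ Cδ hη₀ hCδ
  refine ⟨min κ (η₀ / 2), lt_min hκ (by positivity), Kp, hKp, ?_⟩
  intro δ hδs heven hδ hκ' hκ₂ μ hμ hlo hhi P w N Nh J hw hw1 hN hNh hNN hJ hδw
  have hκle : min κ (η₀ / 2) ≤ κ := min_le_left _ _
  have hκη : min κ (η₀ / 2) ≤ η₀ / 2 := min_le_right _ _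
  obtain ⟨B, -⟩ : ∃ B : BandBounds a b, B = bandBounds ha hab hb := ⟨_, rfl⟩
  have h2ne : (2 : WithTop ℕ∞) ≠ 0 := by norm_num
  have hu : ∀ θ, IsBandFermiRadius (μ - δ (perturbedFermiRadius δ μ θ • dir θ)) θ (perturbedFermiRadius δ μ θ) :=
    isBandFermiRadius_perturbedFermiRadius B (hδs.continuous) (fun k _ => hδ k) (by linarith) (by linarith)
  exact h δ hδs heven (fun k => (hδ k).trans hκle) (fun k => (hκ' k).trans hκle) (fun k => (hκ₂ k).trans hκle) μ hμ hlo hhi _ hu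
    P w N Nh J hw hw1 hN hNh hNN hJ hδw

end Summit.HubbardSuperconductivity.HubbardSuperconductivity.Theorems.PerturbedFermiCurve

end
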